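import Mathlib
import Literature.Analysis.FluidPDE.SuitableWeak
import Literature.Analysis.FluidPDE.WeakGradientSlicing
import Literature.Analysis.FluidPDE.NSBoundedSpatialHolder
import Literature.Analysis.FluidPDE.LocalLeraySlabGoodSlices
import Summits.NavierStokesRegularity.NavierStokesRegularity.Theorems.EulerZoomLiouvillePowerGaugeEulerLiouvilleIrrotationalTools
import Summits.NavierStokesRegularity.NavierStokesRegularity.Theorems.EulerZoomLiouvillePowerGaugeEulerLiouvilleBackwardTools
import Summits.NavierStokesRegularity.NavierStokesRegularity.Theorems.EulerZoomLiouvillePowerGaugeEulerLiouvilleAllRhoStrata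
import HarnessLib

/-!
# Crux E `PowerGaugeEulerLiouville` (stmt-NavierStokesRegularity-19832): members with a WEAKLY IRROTATIONAL PAST are trivial

Route `EulerZoomLiouville` (NavierStokesRegularity), crux E = Seregin's power-gauged ancient-Euler Liouville
statement.  A member `(u, p, H, c)` of the class (suitable weak Euler pair on `(−∞,0) × ℝ³`, weak spatial gradient
`H`, gauges `a^{2ρ} A(a) + a^{ρ} E(a) + a^{2ρ} D(a) ≤ c`, `ρ > 0`) whose weak gradient is a.e. SYMMETRIC ON A PAST
SUB-SLAB `(−∞, T₁) × ℝ³`, `T₁ ≤ 0` (`curl u = 0` weakly before `T₁`; NOTHING is assumed on `[T₁, 0)`, and no regularity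
beyond the class), vanishes a.e. on the whole slab (`PastWeak.ae_eq_zero_of_gauge_of_pastWeaklyIrrotational`).
The tree's whole-slab stratum `ae_eq_zero_of_gauge_of_irrotational` (`…Irrotational.lean`) is the case `T₁ = 0`;
the interim lead's `PastIrrotational.ae_eq_zero_of_gauge_of_pastIrrotational` (p595761) is the case of `C²`
slices.  Proof: for a.e. `t < T₁` the slice `u(t)` has the symmetric (hypothesis), trace-free (`div u = 0`,
`SerrinBoundedHolder.ae_trace_eq_zero`) weak gradient `H(t)` (`HasWeakSpatialGradientOn.ae_hasWeakFDerivOn_slice_slab`)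
and the `A`-gauge growth `∫_{B_r} |u(t)|² ≤ c r^{1−2ρ}` for `r > √(−t)` (`Backward.lintegral_ball_le_of_gaugeA`), so
it vanishes by the weak harmonic Liouville theorem `ae_eq_zero_of_symm_traceFree_of_growth`; hence the member
has an energy-quiescent past and is trivial by `ae_eq_zero_of_gauge_of_energyVanishing_allRho`.
WHAT THIS IS NOT: not NS regularity, not the crux `E` — a WEAK past stratum of it for the lead skeleton
`Cruxes/PowerGaugeEulerLiouville/Lines/birth.lean` (interim LEAD ns-typeII-p2 g9).
-/

noncomputable section

set_option linter.dupNamespace false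

open MeasureTheory Set Filter Topology Metric Function TopologicalSpace
open scoped ENNReal NNReal RealInnerProductSpace

namespace Summit.NavierStokesRegularity.NavierStokesRegularity.Theorems.PowerGaugeEulerLiouville.PastWeak

open Literature.Analysis Literature.Analysis.FunctionSpaces Literature.Analysis.FluidPDE

/-- **Members of the power-gauged class with a WEAKLY IRROTATIONAL PAST are trivial.**  Let `(u, p)` be a
suitable weak Euler pair on `(−∞,0) × ℝ³` with weak spatial gradient `H` and gauges
`a^{2ρ} A(a) + a^{ρ} E(a) + a^{2ρ} D(a) ≤ c` (`ρ > 0`), and suppose `H` is a.e. symmetric on `(−∞, T₁) × ℝ³` for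
some `T₁ ≤ 0`.  Then `u = 0` a.e. on the slab: a.e. slice before `T₁` is weakly curl- and divergence-free with
sub-volume quadratic growth, hence zero (`ae_eq_zero_of_symm_traceFree_of_growth`), and an energy-quiescent
past makes the member trivial (`ae_eq_zero_of_gauge_of_energyVanishing_allRho`). [folklore] -/
theorem ae_eq_zero_of_gauge_of_pastWeaklyIrrotational {ρ : ℝ} (hρ : 0 < ρ)
    {u : ℝ → EuclideanSpace ℝ (Fin 3) → EuclideanSpace ℝ (Fin 3)} {p : ℝ → EuclideanSpace ℝ (Fin 3) → ℝ}
    {H : ℝ → EuclideanSpace ℝ (Fin 3) → EuclideanSpace ℝ (Fin 3) →L[ℝ] EuclideanSpace ℝ (Fin 3)} {c : ℝ≥0}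
    (hsw : IsSuitableWeakSolutionOn (slab (EuclideanSpace ℝ (Fin 3)) (Iio 0) isOpen_Iio) 0 0 u p)
    (hH : HasWeakSpatialGradientOn (slab (EuclideanSpace ℝ (Fin 3)) (Iio 0) isOpen_Iio) u H)
    (hc : ∀ a : ℝ, 0 < a → ENNReal.ofReal (a ^ (2 * ρ)) * cknA a (0 : ℝ × EuclideanSpace ℝ (Fin 3)) u +
        ENNReal.ofReal (a ^ ρ) * cknE a (0 : ℝ × EuclideanSpace ℝ (Fin 3)) H +
        ENNReal.ofReal (a ^ (2 * ρ)) * cknD a (0 : ℝ × EuclideanSpace ℝ (Fin 3)) p ≤ (c : ℝ≥0∞))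
    {T₁ : ℝ} (hT₁ : T₁ ≤ 0)
    (hirr : ∀ᵐ z ∂(volume.restrict (Iio T₁ ×ˢ (univ : Set (EuclideanSpace ℝ (Fin 3))))),
      ∀ v w : EuclideanSpace ℝ (Fin 3), ⟪H z.1 z.2 v, w⟫ = ⟪H z.1 z.2 w, v⟫) :
    uncurry u =ᵐ[volume.restrict (Iio (0 : ℝ) ×ˢ (univ : Set (EuclideanSpace ℝ (Fin 3))))] 0 := by
  have hA : ∀ a : ℝ, 0 < a → ENNReal.ofReal (a ^ (2 * ρ)) *
      cknA a (0 : ℝ × EuclideanSpace ℝ (Fin 3)) u ≤ (c : ℝ≥0∞) :=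
    fun a ha => le_trans (le_trans le_self_add le_self_add) (hc a ha)
  have hprod : ∀ S : Set ℝ, (volume : Measure (ℝ × EuclideanSpace ℝ (Fin 3))).restrict
      (S ×ˢ (univ : Set (EuclideanSpace ℝ (Fin 3)))) =
      (volume.restrict S).prod (volume : Measure (EuclideanSpace ℝ (Fin 3))) := by
    intro S
    rw [Measure.volume_eq_prod, Measure.restrict_prod_eq_prod_univ]
  -- ## (1) slices: a.e. `t < 0`, `H t` is a weak gradient of `u t` on `ℝ³`
  have h1 : ∀ᵐ t ∂(volume.restrict (Iio (0 : ℝ))), HasWeakGradient (u t) (H t) := by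
    -- adapted from Theorems/EulerZoomLiouvillePowerGaugeEulerLiouvilleIrrotational.lean
    have hcov : Iio (0 : ℝ) = ⋃ n : ℕ, Ioo (-((n : ℝ) + 1)) 0 := by
      refine subset_antisymm (fun t ht => ?_) (iUnion_subset fun n t ht => ht.2)
      obtain ⟨n, hn⟩ := exists_nat_gt (-t)
      exact mem_iUnion.2 ⟨n, ⟨by linarith, ht⟩⟩
    rw [hcov, ae_restrict_iUnion_iff]
    intro n
    have hn : HasWeakSpatialGradientOn
        (slab (EuclideanSpace ℝ (Fin 3)) (Ioo (-((n : ℝ) + 1)) 0) isOpen_Ioo) u H :=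
      hH.mono (slab_mono Ioo_subset_Iio_self)
    exact hn.ae_hasWeakFDerivOn_slice_slab
  -- ## (2) symmetric gradient on a.e. slice before `T₁`
  have h2 : ∀ᵐ t ∂(volume.restrict (Iio T₁)), ∀ᵐ x ∂(volume : Measure (EuclideanSpace ℝ (Fin 3))),
      ∀ v w : EuclideanSpace ℝ (Fin 3), ⟪H t x v, w⟫ = ⟪H t x w, v⟫ := by
    rw [hprod] at hirr
    exact Measure.ae_ae_of_ae_prod hirr
  -- ## (3) trace-free gradient (`div u = 0`) on a.e. slice
  have h3 : ∀ᵐ t ∂(volume.restrict (Iio (0 : ℝ))), ∀ᵐ x ∂(volume : Measure (EuclideanSpace ℝ (Fin 3))),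
      ∑ j, H t x (EuclideanSpace.single j (1 : ℝ)) j = 0 := by
    have htr := SerrinBoundedHolder.ae_trace_eq_zero hsw.distributional hH
    have h' : ∀ᵐ z ∂(volume.restrict (Iio (0 : ℝ) ×ˢ (univ : Set (EuclideanSpace ℝ (Fin 3))))),
        ∑ j, H z.1 z.2 (EuclideanSpace.single j (1 : ℝ)) j = 0 := by
      rw [ae_restrict_iff' (measurableSet_Iio.prod MeasurableSet.univ)]
      filter_upwards [htr] with z hz hmem
      exact hz (by simpa [slab] using hmem)
    rw [hprod] at h'
    exact Measure.ae_ae_of_ae_prod h'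
  -- ## (4) every good slice before `T₁` vanishes
  have h1' : ∀ᵐ t ∂(volume.restrict (Iio T₁)), HasWeakGradient (u t) (H t) :=
    ae_restrict_of_ae_restrict_of_subset (Iio_subset_Iio hT₁) h1
  have h3' : ∀ᵐ t ∂(volume.restrict (Iio T₁)), ∀ᵐ x ∂(volume : Measure (EuclideanSpace ℝ (Fin 3))),
      ∑ j, H t x (EuclideanSpace.single j (1 : ℝ)) j = 0 :=
    ae_restrict_of_ae_restrict_of_subset (Iio_subset_Iio hT₁) h3
  have ht : ∀ᵐ t ∂(volume.restrict (Iio T₁)), t < T₁ := by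
    rw [ae_restrict_iff' measurableSet_Iio]
    exact Eventually.of_forall fun t ht => ht
  have hslice : ∀ᵐ t ∂(volume.restrict (Iio T₁)), u t =ᵐ[volume] 0 := by
    filter_upwards [h1', h2, h3', ht] with t h1 h2 h3 htT
    have ht0 : t < 0 := lt_of_lt_of_le htT hT₁
    refine ae_eq_zero_of_symm_traceFree_of_growth h1 h2 h3 (K := (c : ℝ)) (m := 1 - 2 * ρ)
      (r₀ := Real.sqrt (-t)) (by linarith) fun r hr hr0 => ?_
    have hs : t ∈ Ioo (-(r ^ 2)) 0 := by
      refine ⟨?_, ht0⟩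
      have h4 : Real.sqrt (-t) ^ 2 = -t := Real.sq_sqrt (by linarith)
      nlinarith [Real.sqrt_nonneg (-t)]
    exact Backward.lintegral_ball_le_of_gaugeA hr0 (hA r hr0) hs
  have hnull : volume ({t : ℝ | ¬ (u t =ᵐ[volume] (0 : EuclideanSpace ℝ (Fin 3) → EuclideanSpace ℝ (Fin 3)))}
      ∩ Iio T₁) = 0 := by
    have h := hslice
    rw [ae_iff, Measure.restrict_apply' measurableSet_Iio] at h
    exact h
  -- ## (5) energy-quiescent past ⇒ trivial
  refine ae_eq_zero_of_gauge_of_energyVanishing_allRho hρ.le hsw hH hc fun ε _ N => ?_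
  set m : ℝ := min (-N) T₁ with hm
  intro h0
  have hsub : Iio m ⊆ {s : ℝ | s < -N ∧ ∫⁻ x, ‖u s x‖ₑ ^ 2 ≤ ENNReal.ofReal ε} ∪
      ({t : ℝ | ¬ (u t =ᵐ[volume] (0 : EuclideanSpace ℝ (Fin 3) → EuclideanSpace ℝ (Fin 3)))} ∩ Iio T₁) := by
    intro s hs
    have hsN : s < -N := lt_of_lt_of_le hs (min_le_left _ _)
    have hsT : s < T₁ := lt_of_lt_of_le hs (min_le_right _ _)
    by_cases hz : u s =ᵐ[volume] (0 : EuclideanSpace ℝ (Fin 3) → EuclideanSpace ℝ (Fin 3))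
    · left
      refine ⟨hsN, ?_⟩
      have h00 : ∫⁻ x, ‖u s x‖ₑ ^ 2 = 0 := by
        have h1 : (fun x => ‖u s x‖ₑ ^ 2) =ᵐ[volume] fun _ => 0 := by
          filter_upwards [hz] with x hx
          simp [hx]
        rw [lintegral_congr_ae h1, lintegral_zero]
      rw [h00]
      exact zero_le
    · right
      exact ⟨hz, hsT⟩
  have h2' : volume (Iio m) ≤ 0 :=
    calc volume (Iio m) ≤ volume ({s : ℝ | s < -N ∧ ∫⁻ x, ‖u s x‖ₑ ^ 2 ≤ ENNReal.ofReal ε} ∪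
          ({t : ℝ | ¬ (u t =ᵐ[volume] (0 : EuclideanSpace ℝ (Fin 3) → EuclideanSpace ℝ (Fin 3)))} ∩ Iio T₁)) :=
          measure_mono hsub
      _ ≤ volume {s : ℝ | s < -N ∧ ∫⁻ x, ‖u s x‖ₑ ^ 2 ≤ ENNReal.ofReal ε} +
          volume ({t : ℝ | ¬ (u t =ᵐ[volume] (0 : EuclideanSpace ℝ (Fin 3) → EuclideanSpace ℝ (Fin 3)))}
            ∩ Iio T₁) := measure_union_le _ _
      _ = 0 := by rw [h0, hnull, add_zero]
  rw [Real.volume_Iio] at h2'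
  exact absurd h2' (by simp)

end Summit.NavierStokesRegularity.NavierStokesRegularity.Theorems.PowerGaugeEulerLiouville.PastWeak
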